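import Literature.Computability.Complexity.Completeness
import HarnessLib

/-!
# Hirahara's reduction: the explicit identification `Seed × Suf ≃ {0,1}^ℓ`

Topic `Computability/Complexity`. The concrete, coordinate-wise identification by which the
amplified functions `Amp^{f_k}` (seed `(x, (t, b)) ∈ {0,1}^{d} × 𝔽₂^{N+m} × 𝔽₂^{N}`) are read off
NW blocks of a common length `ℓ ≥ d + (N + m) + N` in Hirahara's reduction (ECCC TR22-119, proof of
Lemma 8.3: "`Amp^f : {0,1}^ℓ → {0,1}`, where the last `ℓ − cn` bits are ignored"): the block is the
concatenation `x ‖ t ‖ b ‖ padding`, Booleans read in `𝔽₂` by `bz`. This file builds the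
equivalence (`HiraharaRed.blockEquiv`), the wires (`HiraharaRed.blockLay`) and proves the layout
property `HiraharaRed.Layout.spec` needed by the completeness circuit (`HiraharaRed.mkLayout`), and
packages per-variable amplification data into an `AmpData` with its `Layout` (`HiraharaRed.mkAmpData`).

## References

* S. Hirahara, *NP-hardness of learning programs and partial MCSP*, ECCC TR22-119, proof of
  Lemma 8.3 (p. 28) [Hirahara2022PartialMCSP].
-/

namespace Literature.Computability.Complexity

namespace HiraharaRed

open IWAmp

/-! ### Splitting bit vectors -/

/-- `{0,1}^{a+b} ≃ {0,1}^a × {0,1}^b` by position. [folklore] -/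
def splitEquiv (a b : ℕ) : (Fin (a + b) → Bool) ≃ (Fin a → Bool) × (Fin b → Bool) :=
  ((Equiv.arrowCongr finSumFinEquiv (Equiv.refl Bool)).symm).trans (Equiv.sumArrowEquivProdArrow _ _ _)

/-- The first component of the split reads the first `a` positions. [folklore] -/
@[simp] theorem splitEquiv_fst (a b : ℕ) (u : Fin (a + b) → Bool) (i : Fin a) :
    (splitEquiv a b u).1 i = u (Fin.castAdd b i) := rfl

/-- The second component of the split reads the last `b` positions. [folklore] -/
@[simp] theorem splitEquiv_snd (a b : ℕ) (u : Fin (a + b) → Bool) (j : Fin b) :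
    (splitEquiv a b u).2 j = u (Fin.natAdd a j) := rfl

/-- `Bool ≃ 𝔽₂` by `bz`. [folklore] -/
def boolZEquiv : Bool ≃ ZMod 2 where
  toFun := bz
  invFun z := decide (z ≠ 0)
  left_inv b := by cases b <;> decide
  right_inv z := by revert z; decide

/-- **The seed read off the first `d + (N+m) + N` bits.** [cite: Hirahara2022PartialMCSP, proof of Lemma 8.3 (the seed of Amp inside a block)] -/
def seedEquiv (N d m : ℕ) : (Fin (d + ((N + m) + N)) → Bool) ≃ Seed N d m :=
  (splitEquiv d ((N + m) + N)).trans
    (Equiv.prodCongr (Equiv.refl _)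
      ((splitEquiv (N + m) N).trans
        (Equiv.prodCongr (Equiv.arrowCongr (Equiv.refl _) boolZEquiv)
          (Equiv.arrowCongr (Equiv.refl _) boolZEquiv))))

/-- **The block identification** `Seed × {0,1}^r ≃ {0,1}^ℓ` for `ℓ = d + (N+m) + N + r`.
[cite: Hirahara2022PartialMCSP, proof of Lemma 8.3 ("the last ℓ − cn bits are ignored")] -/
def blockEquiv (N d m r ℓ : ℕ) (hℓ : d + ((N + m) + N) + r = ℓ) :
    Seed N d m × (Fin r → Bool) ≃ (Fin ℓ → Bool) :=
  ((Equiv.prodCongr (seedEquiv N d m).symm (Equiv.refl _)).trans (splitEquiv _ r).symm).trans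
    (Equiv.arrowCongr (finCongr hℓ) (Equiv.refl Bool))

/-- **The wires of the seed bits inside the block.** [cite: Hirahara2022PartialMCSP, proof of Lemma 8.3] -/
def blockLay (N d m r ℓ : ℕ) (hℓ : d + ((N + m) + N) + r = ℓ) : SB N d m → Fin ℓ :=
  fun sb => finCongr hℓ (Fin.castAdd r (match sb with
    | .inl i => Fin.castAdd ((N + m) + N) i
    | .inr (.inl c) => Fin.natAdd d (Fin.castAdd N c)
    | .inr (.inr i) => Fin.natAdd d (Fin.natAdd (N + m) i)))

/-- **Layout property**: reading the block through the wires gives the seed component of the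
identification. [cite: Hirahara2022PartialMCSP, proof of Lemma 8.3] -/
theorem blockEquiv_symm_fst (N d m r ℓ : ℕ) (hℓ : d + ((N + m) + N) + r = ℓ) (y : Fin ℓ → Bool) :
    ((blockEquiv N d m r ℓ hℓ).symm y).1 = seedOf fun sb => y (blockLay N d m r ℓ hℓ sb) := by
  subst hℓ
  rfl

/-! ### Packaging -/

variable {n kA : ℕ}

/-- Raw per-variable amplification data: arity, design universe, Hankel parameter, design, indices.
[cite: Hirahara2022PartialMCSP, proof of Lemma 8.3] -/
structure RawAmp (n kA : ℕ) where
  /-- arity of `f_k` -/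
  N : Fin n → ℕ
  /-- universe of the amplification design -/
  dA : Fin n → ℕ
  /-- Hankel seed parameter -/
  mI : Fin n → ℕ
  /-- the amplification design -/
  eA : (k : Fin n) → Fin kA → (Fin (N k) ↪ Fin (dA k))
  /-- the Hankel index vectors -/
  idxA : (k : Fin n) → Fin kA → Fin (mI k) → ZMod 2

/-- The seed length of variable `k`. [cite: Hirahara2022PartialMCSP, proof of Lemma 8.3] -/
def RawAmp.seedLen (R : RawAmp n kA) (k : Fin n) : ℕ := R.dA k + ((R.N k + R.mI k) + R.N k)

/-- **The amplification data with the explicit block identification** for a common block length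
`ℓ ≥ seedLen k`. [cite: Hirahara2022PartialMCSP, proof of Lemma 8.3] -/
def mkAmpData (R : RawAmp n kA) (ℓ : ℕ) (hℓ : ∀ k, R.seedLen k ≤ ℓ) : AmpData n ℓ kA where
  N := R.N
  dA := R.dA
  mI := R.mI
  eA := R.eA
  idxA := R.idxA
  Suf k := Fin (ℓ - R.seedLen k) → Bool
  Φ k := blockEquiv (R.N k) (R.dA k) (R.mI k) (ℓ - R.seedLen k) ℓ (Nat.add_sub_cancel' (hℓ k))

/-- **Its layout.** [cite: Hirahara2022PartialMCSP, proof of Lemma 8.3] -/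
def mkLayout (R : RawAmp n kA) (ℓ : ℕ) (hℓ : ∀ k, R.seedLen k ≤ ℓ) : Layout (mkAmpData R ℓ hℓ) where
  lay k := blockLay (R.N k) (R.dA k) (R.mI k) (ℓ - R.seedLen k) ℓ (Nat.add_sub_cancel' (hℓ k))
  spec _ y := blockEquiv_symm_fst _ _ _ _ _ _ y

/-- The padding of variable `k` has `2^{ℓ - seedLen k} ≤ 2^ℓ` elements. [folklore] -/
theorem card_Suf_mkAmpData (R : RawAmp n kA) (ℓ : ℕ) (hℓ : ∀ k, R.seedLen k ≤ ℓ) (k : Fin n) :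
    Fintype.card ((mkAmpData R ℓ hℓ).Suf k) = 2 ^ (ℓ - R.seedLen k) := by
  change Fintype.card (Fin (ℓ - R.seedLen k) → Bool) = _
  simp

end HiraharaRed

end Literature.Computability.Complexity
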